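import Mathlib.FieldTheory.Finiteness
import Literature.InformationTheory.QuantumCodes.DistanceThreeSyndromeCriterion
import HarnessLib

/-!
# No `[[n, n−2, 2]]` stabilizer code for odd `n` (Rains 1999, Theorem 2, additive case)

Topic `Literature/InformationTheory/QuantumCodes` (LADDER-QEC, LIT-1 custody: the `d = 2` column of the
`[[n,k,d]]` tables, UPPER side). Everything here is PROVED (no named facts).

**Source.** E. M. Rains, *Quantum codes of minimum distance two*, IEEE Trans. Inform. Theory 45
(1999) 266–271 = arXiv:quant-ph/9704043 [Rains1999DistanceTwo]. Theorem 1 there (chunk p0001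
L88–96): a `((2m, K, 2))` has `K ≤ 4^{m−1}` (quantum Singleton bound) and `((2m, 4^{m−1}, 2))` exist
(the additive `[[2m, 2m−2, 2]]`). For odd length (chunk p0001 L105 – p0002 L12):

> **Theorem 2.** Let `Q` be a `((2m+1, K, 2))` for some `m` and `K`. Then `K ≤ 4^{m−1}(2 − 1/m)`.

(proved there by the linear-programming/shadow bound). For ADDITIVE (stabilizer) codes `K = 2^k`,
and `4^{m−1}(2 − 1/m) < 2^{2m−1}` forces `k ≤ 2m − 2 = n − 3`: **there is no `[[n, n−2, 2]]`
stabilizer code of odd length `n`**, so the `d = 2` column of the code tables reads `k_max = n − 2`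
for even `n` and `k_max = n − 3` for odd `n` (cf. CRSS 1998 Table III; both existence statements are
`Gottesman1997_distance_two` / `CRSS1998_trivialCodes_two_even/odd` in `DistanceTwoCodes.lean`).

**What is proved here.** The additive corollary of Theorem 2, `Rains1999_no_code_odd_length_sub_two :
Odd n → 3 ≤ n → ¬ AdditiveCodeExists n (n − 2) 2`, by an ELEMENTARY stabilizer argument instead of
the printed linear programme (degenerate codes included): a `2`-dimensional self-orthogonal
`S̄ = {0, s, t, s+t}` with no weight-one vector in `S̄⊥ ∖ S̄` either (a) contains a single-qubit
error `P_i`, and then at every other qubit some single-qubit error commutes with `S̄`, hence lies in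
`S̄` — too many for a `4`-element `S̄` once `n ≥ 3`; or (b) contains none, and then `s` and `t` carry
distinct non-identity letters at EVERY qubit, so `((s, t)) = n ≡ 1 (mod 2)`, contradicting
`((s, t)) = 0`. Together with the quantum Singleton bound (`AdditiveCodeExists.quantumSingleton`)
this gives `AdditiveCodeExists n k 2 → Odd n → k + 3 ≤ n` (`Rains1999_theorem2_additive`).

Scope / honesty note. Only the additive (stabilizer) case of Theorem 2 is formalized — the printed
theorem bounds general `((n, K, 2))` codes (e.g. the non-additive `((5, 6, 2))`), which needs the
quantum LP/shadow machinery for non-additive codes; not claimed here.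

## Tree / Mathlib search

`lean search 'n - 2\) 2|Odd n'` in `QuantumCodes/` (2026-08-27): only the existence side
(`DistanceTwoCodes.lean`). Reused: `singleErr`, `pauliPair`, `syndBit`, `sympInner_singleErr`,
`sympWeight_singleErr_le` (quantum-Hamming-bound files), `AdditiveCodeExists.quantumSingleton`.
-/

namespace Literature.InformationTheory.QuantumCodes

open Finset Module

variable {n : ℕ}

/-! ### Letters of a Pauli word -/

/-- The letter `(aᵢ, bᵢ) ∈ 𝔽₂²` of the word `(a|b)` at qubit `i` (`(0,0) = I`, `(1,0) = X`,
`(0,1) = Z`, `(1,1) = Y`). [cite: CalderbankEtAl1998, §2 (printed p. 4: the weight counts the coordinates with aᵢ = 1 or bᵢ = 1)] -/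
def letterAt (v : SympVec n) (i : Fin n) : ZMod 2 × ZMod 2 := (v.1 i, v.2 i)

/-- Letters add coordinatewise. [folklore] -/
private theorem letterAt_add (v w : SympVec n) (i : Fin n) :
    letterAt (v + w) i = letterAt v i + letterAt w i := rfl

/-- The letter of the single-qubit error `E_{i,p}` at `i` is `p`, elsewhere `0`. [folklore] -/
private theorem letterAt_singleErr [DecidableEq (Fin n)] (i j : Fin n) (p : ZMod 2 × ZMod 2) :
    letterAt (singleErr i p) j = if j = i then p else 0 := by
  unfold letterAt singleErr
  by_cases h : j = i
  · subst h; simp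
  · simp [h]

/-- The zero word has identity letters. [folklore] -/
@[simp] private theorem letterAt_zero (i : Fin n) : letterAt (0 : SympVec n) i = 0 := rfl

/-- The syndrome bit of `E_{i,p}` against `v` only depends on the letter of `v` at `i`:
`((v, E_{i,p})) = v₁(i) p₂ + p₁ v₂(i)`. [cite: Gottesman1997, §3.4 (chunk p0021 L55-56)] -/
private theorem sympInner_singleErr_letter (v : SympVec n) (i : Fin n) (p : ZMod 2 × ZMod 2) :
    sympInner v (singleErr i p) = (letterAt v i).1 * p.2 + p.1 * (letterAt v i).2 := by
  rw [sympInner_singleErr]; rfl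

/-- A letter commutes with itself and with the identity. [folklore] -/
private theorem letter_comm_self : ∀ p : ZMod 2 × ZMod 2, p.1 * p.2 + p.1 * p.2 = 0 := by decide

/-- Two DISTINCT non-identity letters anticommute: `a₁ b₂ + b₁ a₂ = 1`. [cite: Gottesman1997, §3.4 (Q(a|b, c|d) = 0 iff commute)] -/
private theorem letter_anticomm : ∀ a b : ZMod 2 × ZMod 2, a ≠ 0 → b ≠ 0 → a ≠ b →
    a.1 * b.2 + b.1 * a.2 = 1 := by decide

/-! ### A two-dimensional stabilizer as a four-element set -/

section TwoDim

open scoped Classical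

/-- `|S̄| = 2^{dim S̄}`. [cite: CalderbankEtAl1998, §2 Thm. 2 (printed p. 9: "an (n, 2^{n−k}) code")] -/
private theorem card_filter_mem_eq (S : Submodule (ZMod 2) (SympVec n)) :
    #{v : SympVec n | v ∈ S} = 2 ^ finrank (ZMod 2) S := by
  rw [← Fintype.card_subtype, Module.card_eq_pow_finrank (K := ZMod 2) (V := S), ZMod.card]

/-- A `2`-dimensional `S̄` containing `s ≠ 0` and `t ∉ {0, s}` is `{0, s, t, s + t}`. [folklore] -/
private theorem mem_twoDim_iff {S : Submodule (ZMod 2) (SympVec n)} (hS : finrank (ZMod 2) S = 2)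
    {s t : SympVec n} (hs : s ∈ S) (ht : t ∈ S) (hs0 : s ≠ 0) (ht0 : t ≠ 0) (hst : t ≠ s)
    {v : SympVec n} (hv : v ∈ S) : v = 0 ∨ v = s ∨ v = t ∨ v = s + t := by
  have hcard : #{v : SympVec n | v ∈ S} = 4 := by rw [card_filter_mem_eq, hS]; norm_num
  have hst' : s + t ≠ 0 := fun h => hst (by
    have := congrArg (· + t) h
    simpa [add_assoc, ZModModule.add_self] using this.symm)
  have hst's : s + t ≠ s := fun h => ht0 (by simpa using h)
  have hst't : s + t ≠ t := fun h => hs0 (by simpa using h)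
  -- the four listed elements exhaust `S̄`
  have hsub : ({0, s, t, s + t} : Finset (SympVec n)) ⊆ Finset.univ.filter fun v => v ∈ S := by
    intro x hx
    simp only [Finset.mem_insert, Finset.mem_singleton] at hx
    rcases hx with rfl | rfl | rfl | rfl
    · simp
    · simpa using hs
    · simpa using ht
    · simpa using S.add_mem hs ht
  have h4 : #({0, s, t, s + t} : Finset (SympVec n)) = 4 := by
    rw [Finset.card_insert_of_notMem, Finset.card_insert_of_notMem, Finset.card_pair hst't.symm]
    · simp only [Finset.mem_insert, Finset.mem_singleton, not_or]
      exact ⟨hst.symm, hst's.symm⟩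
    · simp only [Finset.mem_insert, Finset.mem_singleton, not_or]
      exact ⟨hs0.symm, ht0.symm, hst'.symm⟩
  have heq := Finset.eq_of_subset_of_card_le hsub (by rw [hcard, h4])
  have hv' : v ∈ ({0, s, t, s + t} : Finset (SympVec n)) := by
    rw [heq]; simpa using hv
  simpa only [Finset.mem_insert, Finset.mem_singleton] using hv'

/-- Orthogonality to `s` and `t` is orthogonality to `S̄ = {0, s, t, s+t}`. [folklore] -/
private theorem mem_sympDual_of_twoDim {S : Submodule (ZMod 2) (SympVec n)}
    (hS : finrank (ZMod 2) S = 2) {s t : SympVec n} (hs : s ∈ S) (ht : t ∈ S) (hs0 : s ≠ 0)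
    (ht0 : t ≠ 0) (hst : t ≠ s) {w : SympVec n} (hsw : sympInner s w = 0)
    (htw : sympInner t w = 0) : w ∈ sympDual S := by
  rw [mem_sympDual_iff]
  intro v hv
  rcases mem_twoDim_iff hS hs ht hs0 ht0 hst hv with rfl | rfl | rfl | rfl
  · exact sympInner_zero_left w
  · exact hsw
  · exact htw
  · rw [sympInner_add_left, hsw, htw, add_zero]

end TwoDim

/-! ### The theorem -/

section Main

open scoped Classical

/-- In a distance-`2` code, a single-qubit error commuting with the stabilizer lies in it
(`HasMinDist S̄ 2`, contraposed). [cite: CalderbankEtAl1998, §2 Thm. 1 (printed p. 4: "no vectors of weight ≤ d−1 in S̄⊥∖S̄")] -/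
private theorem singleErr_mem_of_mem_sympDual {S : Submodule (ZMod 2) (SympVec n)}
    (hd : HasMinDist S 2) {i : Fin n} {p : ZMod 2 × ZMod 2}
    (h : singleErr i p ∈ sympDual S) : singleErr i p ∈ S := by
  by_contra hnot
  have := hd _ h hnot
  have := sympWeight_singleErr_le i p
  omega

/-- **No `[[n, n−2, 2]]` stabilizer code of odd length** (the additive case of Rains' Theorem 2:
`K = 2^{n−2} > 4^{m−1}(2 − 1/m)` for `n = 2m+1`), degenerate codes included.
[cite: Rains1999DistanceTwo, Thm. 2 (arXiv:quant-ph/9704043 chunk p0001 L109 – p0002 L12)] -/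
theorem Rains1999_no_code_odd_length_sub_two (hn : Odd n) (h3 : 3 ≤ n) :
    ¬ AdditiveCodeExists n (n - 2) 2 := by
  rintro ⟨S, hself, hdim, hdist, -⟩
  have hS : finrank (ZMod 2) S = 2 := by omega
  -- single-qubit errors commuting with `s` and `t` lie in `S̄`
  have key : ∀ {s t : SympVec n}, s ∈ S → t ∈ S → s ≠ 0 → t ≠ 0 → t ≠ s →
      ∀ (i : Fin n) (p : ZMod 2 × ZMod 2), sympInner s (singleErr i p) = 0 →
        sympInner t (singleErr i p) = 0 →
        singleErr i p = 0 ∨ singleErr i p = s ∨ singleErr i p = t ∨ singleErr i p = s + t := by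
    intro s t hs ht hs0 ht0 hst i p hsE htE
    have hE := singleErr_mem_of_mem_sympDual hdist
      (mem_sympDual_of_twoDim hS hs ht hs0 ht0 hst hsE htE)
    exact mem_twoDim_iff hS hs ht hs0 ht0 hst hE
  -- pick `s ≠ 0` in `S̄`, preferring a single-qubit error if there is one
  by_cases hA : ∃ (i : Fin n) (p : ZMod 2 × ZMod 2), p ≠ 0 ∧ singleErr i p ∈ S
  · -- Case (a): `s = E_{i,p} ∈ S̄`
    obtain ⟨i, p, hp, hs⟩ := hA
    set s := singleErr i p with hsdef
    have hs0 : s ≠ 0 := fun h => hp (by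
      have := congrArg (fun v => letterAt v i) h
      simpa [hsdef, letterAt_singleErr] using this)
    -- a second element `t ∈ S̄ ∖ {0, s}`
    obtain ⟨t, ht, ht0, hts⟩ : ∃ t ∈ S, t ≠ 0 ∧ t ≠ s := by
      by_contra hno
      push Not at hno
      have hsub : (Finset.univ.filter fun v : SympVec n => v ∈ S) ⊆ {0, s} := by
        intro v hv
        simp only [Finset.mem_filter, Finset.mem_univ, true_and] at hv
        simp only [Finset.mem_insert, Finset.mem_singleton]
        by_cases hv0 : v = 0
        · exact Or.inl hv0
        · exact Or.inr (hno v hv hv0)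
      have := Finset.card_le_card hsub
      rw [card_filter_mem_eq, hS] at this
      have h2 : #({0, s} : Finset (SympVec n)) ≤ 2 := Finset.card_insert_le _ _
      omega
    -- at every qubit `q ≠ i`, some single-qubit error is `t` or `s + t`
    have hC : ∀ q : Fin n, q ≠ i → ∃ b : ZMod 2 × ZMod 2, b ≠ 0 ∧
        (singleErr q b = t ∨ singleErr q b = s + t) := by
      intro q hqi
      have hsq : letterAt s q = 0 := by rw [hsdef, letterAt_singleErr, if_neg hqi]
      by_cases hb : letterAt t q = 0
      · -- then `X_q` commutes with `s` and `t`: impossible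
        exfalso
        have hX := key hs ht hs0 ht0 hts q (1, 0)
          (by rw [sympInner_singleErr_letter, hsq]; simp)
          (by rw [sympInner_singleErr_letter, hb]; simp)
        have hl : letterAt (singleErr q ((1, 0) : ZMod 2 × ZMod 2)) q = (1, 0) := by
          rw [letterAt_singleErr, if_pos rfl]
        rcases hX with h | h | h | h <;> rw [h] at hl
        · rw [letterAt_zero] at hl; exact absurd hl (by decide)
        · rw [hsq] at hl; exact absurd hl (by decide)
        · rw [hb] at hl; exact absurd hl (by decide)
        · rw [letterAt_add, hsq, hb] at hl; exact absurd hl (by decide)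
      · refine ⟨letterAt t q, hb, ?_⟩
        have hE := key hs ht hs0 ht0 hts q (letterAt t q)
          (by rw [sympInner_singleErr_letter, hsq]; simp)
          (by rw [sympInner_singleErr_letter]; exact letter_comm_self _)
        rcases hE with h | h | h | h
        · exact absurd (by simpa [letterAt_singleErr] using congrArg (fun v => letterAt v q) h) hb
        · -- `E_{q,b} = s = E_{i,p}` with `q ≠ i`
          have := congrArg (fun v => letterAt v q) h
          rw [letterAt_singleErr, if_pos rfl, hsq] at this
          exact absurd this hb
        · exact Or.inl h
        · exact Or.inr h
    -- two further qubits `j ≠ m`, both `≠ i`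
    obtain ⟨j, m, hji, hmi, hjm⟩ : ∃ j m : Fin n, j ≠ i ∧ m ≠ i ∧ j ≠ m := by
      have h0 : (⟨0, by omega⟩ : Fin n) ≠ ⟨1, by omega⟩ := by simp
      have h1 : (⟨1, by omega⟩ : Fin n) ≠ ⟨2, by omega⟩ := by simp
      have h2 : (⟨0, by omega⟩ : Fin n) ≠ ⟨2, by omega⟩ := by simp
      by_cases hi0 : i = ⟨0, by omega⟩
      · exact ⟨⟨1, by omega⟩, ⟨2, by omega⟩, by rw [hi0]; exact h0.symm, by rw [hi0]; exact h2.symm, h1⟩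
      by_cases hi1 : i = ⟨1, by omega⟩
      · exact ⟨⟨0, by omega⟩, ⟨2, by omega⟩, by rw [hi1]; exact h0, by rw [hi1]; exact h1.symm, h2⟩
      · exact ⟨⟨0, by omega⟩, ⟨1, by omega⟩, fun h => hi0 h.symm, fun h => hi1 h.symm, h0⟩
    obtain ⟨b, hb, hj⟩ := hC j hji
    obtain ⟨b', hb', hm⟩ := hC m hmi
    -- compare letters at `m` (resp. `j`)
    have lm : letterAt (singleErr j b) m = 0 := by rw [letterAt_singleErr, if_neg hjm.symm]
    have lm' : letterAt (singleErr m b') m = b' := by rw [letterAt_singleErr, if_pos rfl]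
    have lsm : letterAt s m = 0 := by rw [hsdef, letterAt_singleErr, if_neg hmi]
    rcases hj with hj | hj <;> rcases hm with hm | hm
    · rw [← hj] at hm
      have := congrArg (fun v => letterAt v m) hm
      simp only [lm, lm'] at this
      exact hb' this
    · rw [← hj] at hm
      have := congrArg (fun v => letterAt v m) hm
      simp only [lm', letterAt_add, lsm, lm, add_zero] at this
      exact hb' this
    · have hm2 : singleErr m b' + s = singleErr j b := by
        rw [hm, hj, add_comm]
      have := congrArg (fun v => letterAt v m) hm2
      simp only [letterAt_add, lm', lsm, add_zero, lm] at this
      exact hb' this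
    · rw [← hj] at hm
      have := congrArg (fun v => letterAt v m) hm
      simp only [lm, lm'] at this
      exact hb' this
  · -- Case (b): no single-qubit error in `S̄`; pick any `s ≠ 0`, `t ∉ {0, s}`
    push Not at hA
    obtain ⟨s, hs, hs0⟩ : ∃ s ∈ S, s ≠ 0 := by
      by_contra hno
      push Not at hno
      have hsub : (Finset.univ.filter fun v : SympVec n => v ∈ S) ⊆ {0} := by
        intro v hv
        simp only [Finset.mem_filter, Finset.mem_univ, true_and] at hv
        simpa using hno v hv
      have := Finset.card_le_card hsub
      rw [card_filter_mem_eq, hS, Finset.card_singleton] at this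
      omega
    obtain ⟨t, ht, ht0, hts⟩ : ∃ t ∈ S, t ≠ 0 ∧ t ≠ s := by
      by_contra hno
      push Not at hno
      have hsub : (Finset.univ.filter fun v : SympVec n => v ∈ S) ⊆ {0, s} := by
        intro v hv
        simp only [Finset.mem_filter, Finset.mem_univ, true_and] at hv
        simp only [Finset.mem_insert, Finset.mem_singleton]
        by_cases hv0 : v = 0
        · exact Or.inl hv0
        · exact Or.inr (hno v hv hv0)
      have := Finset.card_le_card hsub
      rw [card_filter_mem_eq, hS] at this
      have h2 : #({0, s} : Finset (SympVec n)) ≤ 2 := Finset.card_insert_le _ _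
      omega
    have hst : s + t ∈ S := S.add_mem hs ht
    -- at every qubit, `s` and `t` carry distinct non-identity letters
    have hloc : ∀ q : Fin n, letterAt s q ≠ 0 ∧ letterAt t q ≠ 0 ∧ letterAt s q ≠ letterAt t q := by
      intro q
      -- the generic step: a letter `c ≠ 0` commuting with both `s_q` and `t_q` is impossible
      have step : ∀ c : ZMod 2 × ZMod 2, c ≠ 0 →
          (letterAt s q).1 * c.2 + c.1 * (letterAt s q).2 = 0 →
          (letterAt t q).1 * c.2 + c.1 * (letterAt t q).2 = 0 → False := by
        intro c hc hcs hct
        have hE := key hs ht hs0 ht0 hts q c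
          (by rw [sympInner_singleErr_letter]; exact hcs)
          (by rw [sympInner_singleErr_letter]; exact hct)
        rcases hE with h | h | h | h
        · exact hc (by simpa [letterAt_singleErr] using congrArg (fun v => letterAt v q) h)
        · exact hA q c hc (h ▸ hs)
        · exact hA q c hc (h ▸ ht)
        · exact hA q c hc (h ▸ hst)
      -- now a finite check on the pair of letters `(s_q, t_q)`
      have : ∀ a b : ZMod 2 × ZMod 2,
          (∀ c : ZMod 2 × ZMod 2, c ≠ 0 → a.1 * c.2 + c.1 * a.2 = 0 → b.1 * c.2 + c.1 * b.2 = 0 → False) →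
          a ≠ 0 ∧ b ≠ 0 ∧ a ≠ b := by
        decide
      exact this _ _ step
    -- hence `((s, t)) = n = 1`, contradicting self-orthogonality
    have hortho : sympInner s t = 0 := (mem_sympDual_iff.1 (hself ht)) s hs
    have hsum : sympInner s t = ∑ q : Fin n, ((letterAt s q).1 * (letterAt t q).2 +
        (letterAt t q).1 * (letterAt s q).2) := by
      simp only [sympInner, dotProduct, ← Finset.sum_add_distrib, letterAt]
    rw [hsum, Finset.sum_congr rfl fun q _ => letter_anticomm _ _ (hloc q).1 (hloc q).2.1 (hloc q).2.2,
      Finset.sum_const, Finset.card_univ, Fintype.card_fin, nsmul_eq_mul, mul_one] at hortho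
    rw [(ZMod.natCast_eq_one_iff_odd).2 hn] at hortho
    exact one_ne_zero hortho

/-- **Rains' Theorem 2, additive case**: a stabilizer code `[[n, k, 2]]` of odd length `n ≥ 3` has
`k ≤ n − 3` (for `k ≥ n − 1` this is the quantum Singleton bound; `k = n − 2` is excluded by
`Rains1999_no_code_odd_length_sub_two`). With `CRSS1998_trivialCodes_two_odd` (existence of
`[[n, n−3, 2]]`) the `d = 2` column for odd `n` is exactly `k ≤ n − 3`.
[cite: Rains1999DistanceTwo, Thm. 2 (arXiv:quant-ph/9704043 chunk p0001 L109 – p0002 L12)] -/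
theorem Rains1999_theorem2_additive {k : ℕ} (hn : Odd n) (h3 : 3 ≤ n) (h : AdditiveCodeExists n k 2) :
    k + 3 ≤ n := by
  by_contra hlt
  have hk : n - 2 ≤ k := by omega
  rcases Nat.lt_or_ge k (n - 1) with hlt' | hge
  · -- `k = n - 2`
    have hk2 : k = n - 2 := by omega
    exact Rains1999_no_code_odd_length_sub_two hn h3 (hk2 ▸ h)
  · -- `k ≥ n - 1`: Singleton `k + 4 ≤ n + 2`
    have := h.quantumSingleton (by omega)
    omega

/-- Instance beyond the printed tables (`n ≤ 30` is CRSS Table III / census territory): no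
`[[31, 29, 2]]` stabilizer code. [cite: Rains1999DistanceTwo, Thm. 2] -/
theorem no_code_31_29_2 : ¬ AdditiveCodeExists 31 29 2 :=
  Rains1999_no_code_odd_length_sub_two (n := 31) (by decide) (by norm_num)

end Main

end Literature.InformationTheory.QuantumCodes
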